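import Summits.QuantumAdvantage.QuantumAdvantage.Theorems.SosSandwichTransferPBMachineDefs
import Summits.QuantumAdvantage.QuantumAdvantage.Theorems.SosSandwichTransferPBThresholdEstimate
import HarnessLib

/-!
# Crux `TransferPB` (stmt-QuantumAdvantage-15238, route SosSandwich), line `birth` — `stub_pbOracleSimulation` SPLIT into (Q) a PromiseBQP membership and (M) a transcript machine

With the node-test promise problem `nodeProblem F r c k` and the advisor `derivedAdvisor F x g` a machine derives
from an answer function `g` FIXED (`Theorems/SosSandwichTransferPBMachineDefs.lean`), the hypothesis `hmach` of
`SimTreePB.stub_pbOracleSimulation_of_bbbvMachines` (`Theorems/SosSandwichTransferPBQueryMagnitude.lean`) splits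
into two INDEPENDENT obligations:

* (Q) `nodeProblem F r c k ∈ PromiseBQP` for all `c k`, uniform `F`, `r` (uniform estimator circuits for block
  query magnitudes and means of restricted runs over a `2T`-wise independent hashed completion; XL);
* (M) a polynomial-time transcript machine `C` with `C^{A ⊕ g}(x) = [advTree (derivedAdvisor F x g) D (A) ≥ 1/2]`
  for ALL `x, g, A` (heavy-prefix descent with BLOCK/SINGLE queries to `g`, one `A`-query per round, 40 MEAN
  queries, `D = machineBudget F x r c k`; L).

This file proves the clauses of the BBBV form for the derived advisor from the mere CONSISTENCY of `g` with
`nodeProblem` — `derivedAdvisor_pick_some` (a pick is a free bit with `m_s(ρ) ≥ w/2`), `derivedAdvisor_pick_none`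
(a refusal certifies `m_s(ρ) < w` for every free bit: a free bit with `m_s ≥ w` passes all its prefix-block tests
and its single test, so it is kept), `derivedAdvisor_val` (`1/40 ≤ 1/20`-accurate leaf values,
`thresholdCount_forty`) — and assembles **`stub_pbOracleSimulation_of_nodeProblem : (Q) → (M) →
Sig.stub_pbOracleSimulation`**. All proved; (Q) and (M) are plain `Prop` arguments (D-0026, no named fact).
Source: S. Aaronson, A. Ambainis, Theory Comput. 10 (2014), proof of Thm. 23 (p. 14); C. H. Bennett,
E. Bernstein, G. Brassard, U. Vazirani, SIAM J. Comput. 26 (1997), Cor. 3.4 (heavy strings are few).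
-/

-- D-0017: single-conjunct summit ⇒ the duplicate `QuantumAdvantage.QuantumAdvantage` is mandated.
set_option linter.dupNamespace false

noncomputable section

namespace Summit.QuantumAdvantage.QuantumAdvantage.Cruxes.TransferPB.Birth

open Finset MeasureTheory Literature.Computability.Cryptography Literature.Computability.Complexity
  Literature.Computability.QuantumComplexity Literature.Computability.QuantumComplexity.ClassicalSimulation
open Summit.QuantumAdvantage.QuantumAdvantage.Theses.SosSandwich
open scoped ENNReal

namespace SimTreePB

section Basics

variable (F : QCircuitFamily cliffordT) (x : List Bool) (r : Polynomial ℕ) (c k : ℕ)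

/-- The threshold `w` is positive. [folklore] -/
theorem pbThreshold_pos : 0 < pbThreshold F x r c k := by
  unfold pbThreshold
  have hd : (0 : ℝ) < thm23Degree F x := by
    have : 1 ≤ thm23Degree F x := by unfold thm23Degree; omega
    exact_mod_cast this
  positivity

/-- Magnitudes are nonnegative. [folklore] -/
theorem bbbvMag_nonneg (ρ : List (Fin (numOracleBits F x) × Bool)) (s : Fin (numOracleBits F x)) :
    0 ≤ bbbvMag F x ρ s :=
  boolAvg_nonneg fun _ => mul_nonneg (by positivity) (List.sum_nonneg (queryWeights_nonneg _ _ _ _))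

/-- A bit's magnitude is at most the magnitude of any block containing its string. [folklore] -/
theorem bbbvMag_le_blockMag (ρ : List (Fin (numOracleBits F x) × Bool)) {s : Fin (numOracleBits F x)}
    {u : List Bool} (hu : u <+: bitString F x s) : bbbvMag F x ρ s ≤ blockMag F x ρ u := by
  classical
  unfold blockMag
  exact Finset.single_le_sum (f := fun t => bbbvMag F x ρ t) (fun t _ => bbbvMag_nonneg F x ρ t)
    (mem_filter.2 ⟨mem_univ _, hu⟩)

/-- The node mean lies in `[0, 1]`. [folklore] -/
theorem nodeMean_mem (ρ : List (Fin (numOracleBits F x) × Bool)) :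
    0 ≤ nodeMean F x ρ ∧ nodeMean F x ρ ≤ 1 := by
  have hbd := restrictPath_bound ρ (p := acceptPoly F x) (acceptPoly_bounded F x cliffordT_isUnitary_holds)
  refine ⟨boolAvg_nonneg fun y => (hbd y).1, ?_⟩
  unfold nodeMean boolAvg
  rw [div_le_one (by positivity)]
  calc ∑ y, evalBool (restrictPath ρ (acceptPoly F x)) y ≤ ∑ _y : Fin (numOracleBits F x) → Bool, (1 : ℝ) :=
        Finset.sum_le_sum fun y _ => (hbd y).2
    _ = 2 ^ numOracleBits F x := by rw [sum_const_cube, mul_one]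

end Basics

/-! ### Consequences of consistency with `nodeProblem` -/

section Consistent

variable {F : QCircuitFamily cliffordT} {x : List Bool} {r : Polynomial ℕ} {c k : ℕ} {g : List Bool → Bool}

/-- A heavy block is answered `true`. [folklore] -/
theorem answer_block_true (hgy : ∀ v ∈ (nodeProblem F r c k).yes, g v = true)
    {ρ : List (Fin (numOracleBits F x) × Bool)} {u : List Bool}
    (h : pbThreshold F x r c k ≤ blockMag F x ρ u) : g (encBlock F x ρ u) = true :=
  hgy _ ⟨x, ρ, Or.inl ⟨u, rfl, h⟩⟩

/-- A heavy bit is answered `true`. [folklore] -/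
theorem answer_single_true (hgy : ∀ v ∈ (nodeProblem F r c k).yes, g v = true)
    {ρ : List (Fin (numOracleBits F x) × Bool)} {s : Fin (numOracleBits F x)}
    (h : pbThreshold F x r c k ≤ bbbvMag F x ρ s) : g (encSingle F x ρ s) = true :=
  hgy _ ⟨x, ρ, Or.inr (Or.inl ⟨s, rfl, h⟩)⟩

/-- A light bit is answered `false`. [folklore] -/
theorem answer_single_false (hgn : ∀ v ∈ (nodeProblem F r c k).no, g v = false)
    {ρ : List (Fin (numOracleBits F x) × Bool)} {s : Fin (numOracleBits F x)}
    (h : bbbvMag F x ρ s ≤ pbThreshold F x r c k / 2) : g (encSingle F x ρ s) = false :=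
  hgn _ ⟨x, ρ, Or.inr (Or.inl ⟨s, rfl, h⟩)⟩

/-- A passed mean threshold is answered `true`. [folklore] -/
theorem answer_mean_true (hgy : ∀ v ∈ (nodeProblem F r c k).yes, g v = true)
    {ρ : List (Fin (numOracleBits F x) × Bool)} {j : ℕ} (h1 : 1 ≤ j) (h40 : j ≤ 40)
    (h : (j : ℝ) / 40 ≤ nodeMean F x ρ) : g (encMean F x ρ j) = true :=
  hgy _ ⟨x, ρ, Or.inr (Or.inr ⟨j, rfl, h1, h40, h⟩)⟩

/-- A failed mean threshold is answered `false`. [folklore] -/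
theorem answer_mean_false (hgn : ∀ v ∈ (nodeProblem F r c k).no, g v = false)
    {ρ : List (Fin (numOracleBits F x) × Bool)} {j : ℕ} (h1 : 1 ≤ j) (h40 : j ≤ 40)
    (h : nodeMean F x ρ ≤ ((j : ℝ) - 1) / 40) : g (encMean F x ρ j) = false :=
  hgn _ ⟨x, ρ, Or.inr (Or.inr ⟨j, rfl, h1, h40, h⟩)⟩

/-- **Pick clause**: a picked bit is FREE and has magnitude `≥ w/2` (its single test was answered `true`).
[cite: AaronsonAmbainis2014, Thm. 23 (proof, p. 14)] -/
theorem derivedAdvisor_pick_some (hgn : ∀ v ∈ (nodeProblem F r c k).no, g v = false)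
    {ρ : List (Fin (numOracleBits F x) × Bool)} {s : Fin (numOracleBits F x)}
    (h : (derivedAdvisor F x g).pick ρ = some s) :
    s ∉ ρ.map Prod.fst ∧ pbThreshold F x r c k / 2 ≤ bbbvMag F x ρ s := by
  classical
  unfold derivedAdvisor at h
  dsimp only at h
  split_ifs at h with hex
  injection h with h
  have hspec := Fin.find_spec (p := fun s => s ∉ ρ.map Prod.fst ∧ Kept F x g ρ s) hex
  rw [h] at hspec
  refine ⟨hspec.1, ?_⟩
  by_contra hlt
  have hle : bbbvMag F x ρ s ≤ pbThreshold F x r c k / 2 := (not_le.1 hlt).le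
  have hfalse := answer_single_false hgn hle
  rw [hspec.2.2] at hfalse
  exact Bool.noConfusion hfalse

/-- **Refusal clause**: if no free bit is kept then every FREE bit has magnitude `< w` — a free bit with
`m_s(ρ) ≥ w` makes every prefix block of its string heavy (`M_u ≥ m_s ≥ w`), so all its tests are answered
`true` and it is kept. [cite: BennettBernsteinBrassardVazirani1997, Cor. 3.4] -/
theorem derivedAdvisor_pick_none (hgy : ∀ v ∈ (nodeProblem F r c k).yes, g v = true)
    {ρ : List (Fin (numOracleBits F x) × Bool)} (h : (derivedAdvisor F x g).pick ρ = none) :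
    ∀ s : Fin (numOracleBits F x), s ∉ ρ.map Prod.fst → bbbvMag F x ρ s < pbThreshold F x r c k := by
  classical
  intro s hs
  by_contra hge
  have hge' : pbThreshold F x r c k ≤ bbbvMag F x ρ s := not_lt.1 hge
  have hkept : Kept F x g ρ s :=
    ⟨fun j _ => answer_block_true hgy (hge'.trans (bbbvMag_le_blockMag F x ρ (List.take_prefix j _))),
      answer_single_true hgy hge'⟩
  unfold derivedAdvisor at h
  dsimp only at h
  rw [dif_pos ⟨s, hs, hkept⟩] at h
  exact absurd h (Option.some_ne_none _)

/-- **Value clause**: the leaf value `#{j ≤ 40 : MEAN answered true}/40` is `1/20`-accurate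
(`thresholdCount_forty`). [folklore] -/
theorem derivedAdvisor_val (hgy : ∀ v ∈ (nodeProblem F r c k).yes, g v = true)
    (hgn : ∀ v ∈ (nodeProblem F r c k).no, g v = false) (ρ : List (Fin (numOracleBits F x) × Bool)) :
    |(derivedAdvisor F x g).val ρ - boolAvg (evalBool (restrictPath ρ (acceptPoly F x)))| ≤ 1 / 20 := by
  obtain ⟨h0, h1⟩ := nodeMean_mem F x ρ
  have h := thresholdCount_forty h0 h1 (fun j => g (encMean F x ρ j))
    (fun j hj hle => answer_mean_true hgy (mem_Icc.1 hj).1 (mem_Icc.1 hj).2 hle)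
    (fun j hj hle => answer_mean_false hgn (mem_Icc.1 hj).1 (mem_Icc.1 hj).2 hle)
  exact h

end Consistent

/-! ### The split -/

/-- **`stub_pbOracleSimulation` from (Q) and (M).** If (Q) the node-test promise problem `nodeProblem F r c k`
is in `PromiseBQP` for all constants `c, k`, uniform `F` and polynomials `r`, and (M) for the same data there is a
polynomial-time transcript machine whose run with the combined oracle `A ⊕ g` on `x` outputs the threshold bit
of the advised tree of `derivedAdvisor F x g` with budget `machineBudget F x r c k` at the relevant bits of `A`
(for ALL `x`, `g`, `A`), then the registered stub `Sig.stub_pbOracleSimulation` holds.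
[cite: AaronsonAmbainis2014, Thm. 23 (proof, p. 14)] -/
theorem stub_pbOracleSimulation_of_nodeProblem
    (hQ : ∀ (c k : ℕ) (F : QCircuitFamily cliffordT), F.IsUniform → ∀ r : Polynomial ℕ,
      nodeProblem F r c k ∈ Literature.Computability.Cryptography.PromiseBQP)
    (hM : ∀ (c k : ℕ) (F : QCircuitFamily cliffordT), F.IsUniform → ∀ r : Polynomial ℕ,
      ∃ (C : OracleAlg Bool) (q : Polynomial ℕ),
        C.IsPolyTime Computability.encodingBoolBool ∧
        (∀ (O : Oracle) (x : List Bool), ∀ y ∈ C.queries O (q.eval x.length) x, y.length ≤ q.eval x.length) ∧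
        ∀ (x : List Bool) (g : List Bool → Bool) (A : Set (List Bool)),
          C.run (Oracle.ofLanguage {w : List Bool | ∃ v : List Bool,
              (w = false :: v ∧ v ∈ A) ∨ (w = true :: v ∧ g v = true)}) (q.eval x.length) x =
            some (decide (1 / 2 ≤
              (advTree (derivedAdvisor F x g) (machineBudget F x r c k) []).eval (oracleBits F x A)))) :
    Sig.stub_pbOracleSimulation := by
  refine stub_pbOracleSimulation_of_bbbvMachines fun c k F hF r => ?_
  obtain ⟨C, q, hCpoly, hCq, hrun⟩ := hM c k F hF r
  refine ⟨nodeProblem F r c k, hQ c k F hF r, C, q, hCpoly, hCq, fun x hx g hgy hgn => ?_⟩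
  refine ⟨derivedAdvisor F x g, pbThreshold F x r c k / 2, machineBudget F x r c k,
    half_pos (pbThreshold_pos F x r c k), Nat.succ_pos _, ?_, ?_, ?_, ?_, fun A => hrun x g A⟩
  · -- budget
    unfold machineBudget pbThreshold
    push_cast
    exact (Nat.le_ceil _).trans (le_add_of_nonneg_right zero_le_one)
  · -- picks: free, magnitude ≥ w/2
    intro ρ i h
    exact derivedAdvisor_pick_some hgn h
  · -- refusals: every free magnitude < w
    intro ρ h i hi
    exact derivedAdvisor_pick_none hgy h i hi
  · -- values
    exact derivedAdvisor_val hgy hgn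

end SimTreePB

end Summit.QuantumAdvantage.QuantumAdvantage.Cruxes.TransferPB.Birth

end
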